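import Literature.NumberTheory.Irrationality.Zudilin2014.SecondTalePolar
import Summits.KontsevichZagierPeriods.Zeta5Search.SecondTaleLargePrime
import Summits.KontsevichZagierPeriods.Zeta5Search.TwoTaleWhippleD1

/-!
# RUNG D1 = L(1/3), second tale: `A_k, B_k ∈ ℤ_p` for the large primes `p > 25n` (file F7 of the D1 note)

HONEST FRAMING: systematic search; no irrationality claim unless certified.  Cell pub-zeta5 (P1 g12 draft of F7 of
fam-denom's `families/denom/D1-DESIGN-NOTE.md`; 'fam-denom (or P1)').  Denominator side only; nothing about
irrationality.  For a prime `p > 25n` at the Remark-5 partner `(aTD1 n, bTD1 n) = (47n+2; 16n+1, 19n+1, 22n+1 |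
22n+2; 9n+1, 35n+2, 38n+2)` of D1 the GENERIC large-prime lemma `SecondTaleLargePrime` applies
(`largePrimeD1`: spans `25n, 7n`, pole span `19n+1`), so
* `padicNorm_coefAT_le_one_D1` — `‖A_k‖_p ≤ 1` on `22n+1 ≤ k ≤ 35n+1`,
* `padicNorm_coefBT_le_one_D1` — `‖B_k‖_p ≤ 1` on `19n+1 ≤ k ≤ 38n+1`
(eq. (T3) of [Zudilin2014ZetaTwo, §6] at the primes not dividing `D_{25n}`), with NO digit counting (contrast the
P15 file `TwoTaleP15SliceLemmas`, which went through the δ-refined digit stack).  Also the range/multiplicity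
bookkeeping of the partner used by the slice file `TwoTaleD1Slice`: `rangeBD1_eq` (`â₂* = 19n+1`,
`b̂₃* = 38n+2`, `â₀* = 38n+2`), `multT_D1_*`, `coefAT_eq_zero_of_simple_D1`, `padicNorm_normT_D1` (`Π̂` is a
`p`-unit for `p > 25n`).
-/

noncomputable section

namespace Summit.KontsevichZagierPeriods.Zeta5Search.Denom.TwoTaleD1Slice

open Finset Polynomial
open Literature.NumberTheory.Irrationality.Zudilin2014
open Summit.KontsevichZagierPeriods.Zeta5Search.Denom.TwoTaleD1Forms (aTD1 bTD1 aTD1_zero aTD1_one aTD1_two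
  aTD1_three bTD1_zero bTD1_one bTD1_two bTD1_three)
open Summit.KontsevichZagierPeriods.Zeta5Search.TwoTaleWhippleD1 (admissibleTD1)
open Summit.KontsevichZagierPeriods.Zeta5Search.SecondTaleLargePrime

variable {n : ℕ} {p : ℕ} [hp : Fact p.Prime]

omit hp in
/-- **`p > 25n` is a large prime for the D1 partner** (numerator spans `25n`, `7n`; pole span `19n+1`). -/
theorem largePrimeD1 (hp25 : 25 * n < p) : LargePrime p (aTD1 n) (bTD1 n) where
  len0 := by simp; omega
  len1 := by simp; omega
  span := by unfold bMax; simp; omega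

omit hp in
/-- `â₂* = aMid = 19n+1`, `b̂₃* = bMax = 38n+2`, `â₀* = 38n+2` at the D1 partner. -/
theorem rangeBD1_eq (n : ℕ) :
    aMid (aTD1 n) = 19 * (n : ℤ) + 1 ∧ bMax (bTD1 n) = 38 * (n : ℤ) + 2 ∧ a0star (aTD1 n) = 38 * (n : ℤ) + 2 := by
  refine ⟨?_, ?_, ?_⟩
  · unfold aMid; simp; omega
  · unfold bMax; simp; omega
  · unfold a0star aMid; simp; omega

omit hp in
/-- Multiplicities at the partner: simple pole (`multT = 1`) for `19n+1 ≤ k ≤ 22n`. -/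
theorem multT_D1_low {k : ℤ} (h1 : 19 * (n : ℤ) + 1 ≤ k) (h2 : k ≤ 22 * (n : ℤ)) : multT (aTD1 n) (bTD1 n) k = 1 := by
  unfold multT
  rw [if_pos (by simp [mem_Ico]; omega), if_neg (by simp [mem_Ico]; omega)]

omit hp in
/-- Multiplicities at the partner: simple pole (`multT = 1`) for `35n+2 ≤ k ≤ 38n+1`. -/
theorem multT_D1_high {k : ℤ} (h1 : 35 * (n : ℤ) + 2 ≤ k) (h2 : k ≤ 38 * (n : ℤ) + 1) :
    multT (aTD1 n) (bTD1 n) k = 1 := by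
  unfold multT
  rw [if_neg (by simp [mem_Ico]; omega), if_pos (by simp [mem_Ico]; omega)]

omit hp in
/-- `A_k = 0` at the simple poles of the partner (`k ≤ 22n` or `k ≥ 35n+2`). -/
theorem coefAT_eq_zero_of_simple_D1 {k : ℤ} (hk1 : 19 * (n : ℤ) + 1 ≤ k) (hk2 : k ≤ 38 * (n : ℤ) + 1)
    (h : k ≤ 22 * (n : ℤ) ∨ 35 * (n : ℤ) + 2 ≤ k) : coefAT (aTD1 n) (bTD1 n) k = 0 :=
  h.elim (fun h => coefAT_of_simple (multT_D1_low hk1 h)) fun h => coefAT_of_simple (multT_D1_high h hk2)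

/-- **`‖A_k‖_p ≤ 1` for `p > 25n`** on the double-pole range `22n+1 ≤ k ≤ 35n+1`. -/
theorem padicNorm_coefAT_le_one_D1 (hn : 1 ≤ n) (hp25 : 25 * n < p) {k : ℤ} (h1 : 22 * (n : ℤ) + 1 ≤ k)
    (h2 : k ≤ 35 * (n : ℤ) + 1) : padicNorm p (coefAT (aTD1 n) (bTD1 n) k) ≤ 1 :=
  padicNorm_coefAT_le_one_of_large (admissibleTD1 hn) (largePrimeD1 hp25) (by simp [mem_Ico]; omega)
    (by simp [mem_Ico]; omega)

/-- **`‖B_k‖_p ≤ 1` for `p > 25n`** on the whole range `19n+1 ≤ k ≤ 38n+1` — eq. (T3) at the primes `p ∤ D_{25n}`. -/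
theorem padicNorm_coefBT_le_one_D1 (hn : 1 ≤ n) (hp25 : 25 * n < p) {k : ℤ} (h1 : 19 * (n : ℤ) + 1 ≤ k)
    (h2 : k ≤ 38 * (n : ℤ) + 1) : padicNorm p (coefBT (aTD1 n) (bTD1 n) k) ≤ 1 := by
  refine padicNorm_coefBT_le_one_of_large (admissibleTD1 hn) (largePrimeD1 hp25) ?_
  by_cases h : k < 35 * (n : ℤ) + 2
  · exact Or.inl (by simp [mem_Ico]; omega)
  · exact Or.inr (by simp [mem_Ico]; omega)

/-- `Π̂ = normT` is a `p`-unit for `p > 25n` (`(16n)!²/((25n)!(7n)!)`, all factorials below `p`). -/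
theorem padicNorm_normT_D1 (hp25 : 25 * n < p) : padicNorm p (normT (aTD1 n) (bTD1 n)) = 1 := by
  have e2 : bTD1 n 2 - aTD1 n 2 - 1 = 16 * (n : ℤ) := by simp; ring
  have e3 : bTD1 n 3 - aTD1 n 3 - 1 = 16 * (n : ℤ) := by simp; ring
  have e0 : aTD1 n 0 - bTD1 n 0 = 25 * (n : ℤ) := by simp; ring
  have e1 : aTD1 n 1 - bTD1 n 1 = 7 * (n : ℤ) := by simp; ring
  have hp25' : 25 * (n : ℤ) < p := by exact_mod_cast hp25
  unfold normT
  rw [e2, e3, e0, e1, padicNorm.div, padicNorm.mul, padicNorm.mul,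
    padicNorm_facZ_eq_one_of_lt (by positivity) (by omega), padicNorm_facZ_eq_one_of_lt (by positivity) (by omega),
    padicNorm_facZ_eq_one_of_lt (by positivity) (by omega)]
  simp

end Summit.KontsevichZagierPeriods.Zeta5Search.Denom.TwoTaleD1Slice

end
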